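import Summits.CriticalPhenomena.CardyFormulaZ2.Theorems.CardyIKTransportIKLinearTransportWallDominationObsRing
import Summits.CriticalPhenomena.CardyFormulaZ2.Theorems.CardyIKTransportIKLinearTransportWallDominationShift
import Summits.CriticalPhenomena.CardyFormulaZ2.Theorems.CardyIKTransportIKMixedBoxCrossingStubFiniteEnergy

/-!
# `CardyIKTransport.IKLinearTransport` (stmt-CriticalPhenomena-5076), line `pinned-diagram-exchange`, lead c8 wave 3 —
# WALL DOMINATION, planar transfer: thin rings around SHORT wall segments by FINITE ENERGY

Theorem-only support file (`--supports stmt-CriticalPhenomena-5076`, registered stub `thinRing_planar_small`), the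
small-`s` companion of the lead's `thinRing_planar_iso` (which covers `s ≥ N`): for every `N, j` there is `c = c(N, j) > 0`
such that for `1 ≤ s ≤ N` and every position `(a, b)` the ring event `RingSeg a b s (2M + 3s)`, `M = (2j+1)(s+1)`, of the
wall segment `{a} × [b, b+s)` has `ν_univ`-probability `≥ c`.

Route.  (1) FINITE ENERGY, iterated (`allBlack_lower`, from `stub_finiteEnergy` at `S = univ`): `n` distinct cells are
simultaneously black with `μIK`-probability `≥ (9/25)^n` — the event "the cells of `l` are black" is a measurable cylinder
event not reading a further cell `v ∉ l`.  (2) PAINTING THE BAND BLACK (`thinRingObs_of_allBlack`): if every cell of the band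
box `[0, 2s] × [0, 2M+3s)` is black, the configuration lies in the planar thin-ring event `ThinRingObs 0 0 s M` — both links
are the vertical black run down the wall column `s` from the row `M + 2s` of the upper window to the row `M` of the lower
window (`blackPathIn_down`), the chains are trivial.  (3) The band cells form a duplicate-free list of `(2s+1)(2M+3s)` cells
(`exists_bandList`), so `ν_univ (ThinRingObs 0 0 s M) ≥ (9/25)^{(2s+1)(2M+3s)} ≥ (9/25)^{(2N+1)(2M_N+3N)}`; translation
invariance (`stub_thinRingObs_shift`) moves the anchor to `(a - s, b - M - s)` and the enclosure (`stub_thinRingObs_ring`)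
puts that event inside `RingSeg a b s (2M + 3s)`.
-/

noncomputable section

namespace Summit.CriticalPhenomena.CardyFormulaZ2.Theorems.IKLinearTransport.PinnedDiagramExchange.WallDomination

open scoped BigOperators Classical
open MeasureTheory Set
open Literature.Probability.LatticeModels (Site)

namespace ThinRingPlanarSmallStub

/-! ## §1 Finite energy, iterated: painting finitely many cells black -/

/-- The cylinder event "all cells of the list `l` are black" is measurable. -/
theorem measurableSet_allBlack (l : List (Site 2)) : MeasurableSet {x : Obs | ∀ v ∈ l, v ∈ x.1} := by
  induction l with
  | nil =>
    have h : {x : Obs | ∀ v ∈ ([] : List (Site 2)), v ∈ x.1} = Set.univ :=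
      Set.eq_univ_of_forall fun x => by simp
    rw [h]
    exact MeasurableSet.univ
  | cons w l ih =>
    have h : {x : Obs | ∀ v ∈ w :: l, v ∈ x.1} = {x : Obs | w ∈ x.1} ∩ {x : Obs | ∀ v ∈ l, v ∈ x.1} :=
      Set.ext fun x => by simp only [Set.mem_setOf_eq, Set.mem_inter_iff, List.forall_mem_cons]
    rw [h]
    exact (measurableSet_setOf.2 ((measurable_set_mem w).comp measurable_fst)).inter ih

/-- The event "all cells of `l` are black" does not read a cell `v ∉ l`. -/
theorem allBlack_determinedOn {l : List (Site 2)} {v : Site 2} (hv : v ∉ l) :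
    {x : Obs | ∀ w ∈ l, w ∈ x.1} ∈ determinedOn {u : Site 2 | u ≠ v} := by
  intro x y hxy
  simp only [Set.mem_setOf_eq]
  exact forall₂_congr fun w hw => (hxy w (by rintro rfl; exact hv hw)).1

/-- FINITE ENERGY, ITERATED: under the isotropic gauge, the cells of a duplicate-free list `l` are simultaneously black with
probability at least `(9/25)^{|l|}` (induction on `l` with `stub_finiteEnergy`). -/
theorem allBlack_lower : ∀ l : List (Site 2), l.Nodup →
    (9 / 25 : ℝ) ^ l.length ≤ μIK.real (obs Set.univ ⁻¹' {x : Obs | ∀ v ∈ l, v ∈ x.1})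
  | [], _ => by
    haveI := CouplingToLimits.isProbabilityMeasure_μIK
    have h : obs Set.univ ⁻¹' {x : Obs | ∀ v ∈ ([] : List (Site 2)), v ∈ x.1} = Set.univ :=
      Set.eq_univ_of_forall fun ω => by simp
    simp only [List.length_nil, pow_zero, h, probReal_univ, le_refl]
  | (w :: l), hn => by
    obtain ⟨hw, hl⟩ := List.nodup_cons.1 hn
    have ih := allBlack_lower l hl
    have hfe := Summit.CriticalPhenomena.CardyFormulaZ2.Cruxes.IKMixedBoxCrossing.PairedMirrorExploration.stub_finiteEnergy
      Set.univ w _ (measurableSet_allBlack l) (allBlack_determinedOn hw)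
    have h : obs Set.univ ⁻¹' {x : Obs | ∀ v ∈ w :: l, v ∈ x.1} =
        obs Set.univ ⁻¹' {x : Obs | ∀ v ∈ l, v ∈ x.1} ∩ {ω | w ∈ blackSet Set.univ ω} := by
      ext ω
      simp only [Set.mem_preimage, Set.mem_setOf_eq, List.forall_mem_cons, Set.mem_inter_iff]
      exact ⟨fun h => ⟨h.2, h.1⟩, fun h => ⟨h.2, h.1⟩⟩
    rw [h, List.length_cons, pow_succ]
    calc (9 / 25 : ℝ) ^ l.length * (9 / 25) = (9 / 25 : ℝ) * (9 / 25 : ℝ) ^ l.length := mul_comm _ _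
      _ ≤ (9 / 25 : ℝ) * μIK.real (obs Set.univ ⁻¹' {x : Obs | ∀ v ∈ l, v ∈ x.1}) :=
        mul_le_mul_of_nonneg_left ih (by norm_num)
      _ ≤ μIK.real (obs Set.univ ⁻¹' {x : Obs | ∀ v ∈ l, v ∈ x.1} ∩ {ω | w ∈ blackSet Set.univ ω}) := hfe

/-! ## §2 Painting the band black realises the thin ring -/

/-- Vertically adjacent cells (`u` just above `v`) are adjacent in every triangulation `cellGraph A`. -/
theorem cellGraph_adj_of_up (A : Set (Site 2)) {u v : Site 2} (h0 : u 0 = v 0) (h1 : u 1 = v 1 + 1) :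
    (cellGraph A).Adj u v := by
  rw [cellGraph, SimpleGraph.fromRel_adj]
  refine ⟨fun h => ?_, Or.inr (Or.inr (Or.inl ?_))⟩
  · rw [h] at h1
    omega
  · ext i
    fin_cases i
    · simp [h0]
    · simp [h1]

/-- A VERTICAL RUN of black cells of `R` is a black path inside `R`, written downwards: from `![c, y + k]` to `![c, y]`. -/
theorem blackPathIn_down (x : Obs) (R : Set (Site 2)) (c y : ℤ) (k : ℕ)
    (h : ∀ i : ℕ, i ≤ k → (![c, y + i] : Site 2) ∈ x.1 ∧ (![c, y + i] : Site 2) ∈ R) :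
    BlackPathIn x R ![c, y + k] ![c, y] := by
  refine ⟨((List.range (k + 1)).map fun i : ℕ => (![c, y + i] : Site 2)).reverse, ?_, ?_, ?_, ?_⟩
  · rw [List.isChain_reverse, List.isChain_map, List.isChain_range_succ]
    intro m _
    show (cellGraph x.2).Adj ![c, y + ((m + 1 : ℕ) : ℤ)] ![c, y + (m : ℤ)]
    exact cellGraph_adj_of_up x.2 (by simp) (by simp; omega)
  · rw [List.head?_reverse, List.getLast?_map, List.getLast?_range]
    simp
  · rw [List.getLast?_reverse, List.head?_map, List.head?_range]
    simp
  · intro v hv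
    rw [List.mem_reverse, List.mem_map] at hv
    obtain ⟨i, hi, rfl⟩ := hv
    rw [List.mem_range] at hi
    exact h i (by omega)

/-- PAINTING THE BAND BLACK realises the thin ring: if `1 ≤ s` and every cell of the band box `[0, 2s] × [0, 2M+3s)` is
black, the configuration lies in `ThinRingObs 0 0 s M` (both links: the vertical black run down the wall column `s` from the
row `M + 2s` of the upper window to the row `M` of the lower window, which lies in both half-box regions; trivial chains). -/
theorem thinRingObs_of_allBlack {x : Obs} {s M : ℕ} (hs : 1 ≤ s)
    (hall : ∀ v : Site 2, 0 ≤ v 0 → v 0 ≤ 2 * s → 0 ≤ v 1 → v 1 < 2 * M + 3 * s → v ∈ x.1) :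
    x ∈ ThinRingObs 0 0 s M := by
  have hA : ((M : ℤ) + 2 * s) ∈ rowsA 0 s M := by
    simp only [rowsA, Set.mem_setOf_eq]
    omega
  have hB : (M : ℤ) ∈ rowsB 0 s M := by
    simp only [rowsB, Set.mem_setOf_eq]
    omega
  have hpath : ∀ R : Set (Site 2), (∀ v : Site 2, v 0 = s → (M : ℤ) ≤ v 1 → v 1 ≤ M + 2 * s → v ∈ R) →
      BlackPathIn x R (wallCell 0 s ((M : ℤ) + 2 * s)) (wallCell 0 s M) := fun R hR => by
    have hcells : ∀ i : ℕ, i ≤ 2 * s →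
        (![0 + (s : ℤ), (M : ℤ) + i] : Site 2) ∈ x.1 ∧ (![0 + (s : ℤ), (M : ℤ) + i] : Site 2) ∈ R := fun i hi =>
      ⟨hall _ (by simp) (by simp; omega) (by simp; omega) (by simp; omega),
        hR _ (by simp) (by simp) (by simp; omega)⟩
    have h := blackPathIn_down x R (0 + (s : ℤ)) M (2 * s) hcells
    rw [(by norm_num : ((2 * s : ℕ) : ℤ) = 2 * (s : ℤ))] at h
    exact h
  simp only [ThinRingObs, Set.mem_setOf_eq]
  refine ⟨(M : ℤ) + 2 * s, hA, (M : ℤ) + 2 * s, hA, M, hB, M, hB, hpath _ ?_, hpath _ ?_,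
    Relation.ReflTransGen.refl, Relation.ReflTransGen.refl⟩
  · intro v h0 h1 h1'
    simp only [rightRegion, Set.mem_setOf_eq]
    omega
  · intro v h0 h1 h1'
    simp only [leftRegion, Set.mem_setOf_eq]
    omega

/-! ## §3 The band cells as a list -/

/-- THE BAND CELLS as a duplicate-free list of `(2s+1)(2M+3s)` cells: a configuration black on all of them is black on every
cell of the band box `[0, 2s] × [0, 2M+3s)`. -/
theorem exists_bandList (s M : ℕ) : ∃ l : List (Site 2), l.Nodup ∧ l.length = (2 * s + 1) * (2 * M + 3 * s) ∧
    ∀ x : Obs, (∀ v ∈ l, v ∈ x.1) →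
      ∀ v : Site 2, 0 ≤ v 0 → v 0 ≤ 2 * s → 0 ≤ v 1 → v 1 < 2 * M + 3 * s → v ∈ x.1 := by
  refine ⟨(List.range (2 * s + 1) ×ˢ List.range (2 * M + 3 * s)).map
      fun p : ℕ × ℕ => (![(p.1 : ℤ), (p.2 : ℤ)] : Site 2), ?_, ?_, ?_⟩
  · refine (List.nodup_range.product List.nodup_range).map fun p q hpq => ?_
    have h0 := congrFun hpq 0
    have h1 := congrFun hpq 1
    simp at h0 h1
    exact Prod.ext h0 h1
  · rw [List.length_map, List.length_product, List.length_range, List.length_range]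
  · intro x hx v h0 h0' h1 h1'
    have e0 : (((v 0).toNat : ℕ) : ℤ) = v 0 := Int.toNat_of_nonneg h0
    have e1 : (((v 1).toNat : ℕ) : ℤ) = v 1 := Int.toNat_of_nonneg h1
    have hv : v = ![(((v 0).toNat : ℕ) : ℤ), (((v 1).toNat : ℕ) : ℤ)] := by
      ext i
      fin_cases i
      · simp [e0]
      · simp [e1]
    rw [hv]
    refine hx _ (List.mem_map.2 ⟨((v 0).toNat, (v 1).toNat), ?_, rfl⟩)
    rw [List.mem_product, List.mem_range, List.mem_range]
    omega

end ThinRingPlanarSmallStub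

open ThinRingPlanarSmallStub in
/-- **Thin rings around SHORT wall segments (registered stub `thinRing_planar_small`).**  For every `N, j` there is
`c > 0` (namely `(9/25)^{(2N+1)(2(2j+1)(N+1)+3N)}`) such that for `1 ≤ s ≤ N` and every `(a, b)`, with `ν_univ`-probability
`≥ c` no white path meeting the wall segment `{a} × [b, b+s)` reaches sup-distance `2M + 3s`, `M = (2j+1)(s+1)`: paint the
whole band box black (finite energy), read off the planar thin ring, translate, enclose. -/
theorem thinRing_planar_small : ∀ (N j : ℕ), ∃ c : ℝ, 0 < c ∧ ∀ (s : ℕ) (a b : ℤ), 1 ≤ s → s ≤ N →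
    c ≤ (νmix Set.univ).real (RingSeg a b s (2 * ((2 * j + 1) * (s + 1)) + 3 * s)) := by
  intro N j
  refine ⟨(9 / 25 : ℝ) ^ ((2 * N + 1) * (2 * ((2 * j + 1) * (N + 1)) + 3 * N)), by positivity, ?_⟩
  intro s a b hs hsN
  generalize hM : (2 * j + 1) * (s + 1) = M
  obtain ⟨l, hnd, hlen, hl⟩ := exists_bandList s M
  haveI := CouplingToLimits.isProbabilityMeasure_μIK
  haveI : IsProbabilityMeasure (νmix Set.univ) := isProbabilityMeasure_nuMix _
  have hlen' : l.length ≤ (2 * N + 1) * (2 * ((2 * j + 1) * (N + 1)) + 3 * N) := by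
    rw [hlen, ← hM]
    exact Nat.mul_le_mul (by omega)
      (Nat.add_le_add (Nat.mul_le_mul_left _ (Nat.mul_le_mul_left _ (by omega))) (by omega))
  have h1 : (9 / 25 : ℝ) ^ l.length ≤ (νmix Set.univ).real {x : Obs | ∀ v ∈ l, v ∈ x.1} := by
    rw [show (νmix Set.univ).real {x : Obs | ∀ v ∈ l, v ∈ x.1} =
        μIK.real (obs Set.univ ⁻¹' {x : Obs | ∀ v ∈ l, v ∈ x.1}) from
      map_measureReal_apply (CouplingToLimits.measurable_obs _) (measurableSet_allBlack l)]
    exact allBlack_lower l hnd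
  have h2 : {x : Obs | ∀ v ∈ l, v ∈ x.1} ⊆ ThinRingObs 0 0 s M := fun x hx =>
    thinRingObs_of_allBlack hs (hl x hx)
  have h3 : ThinRingObs (a - s) (b - M - s) s M ⊆ RingSeg a b s (2 * M + 3 * s) := by
    have h := stub_thinRingObs_ring (a - s) (b - M - s) s M hs
    rwa [(by ring : a - (s : ℤ) + s = a), (by ring : b - (M : ℤ) - s + M + s = b)] at h
  calc (9 / 25 : ℝ) ^ ((2 * N + 1) * (2 * ((2 * j + 1) * (N + 1)) + 3 * N))
      ≤ (9 / 25 : ℝ) ^ l.length := pow_le_pow_of_le_one (by norm_num) (by norm_num) hlen'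
    _ ≤ (νmix Set.univ).real {x : Obs | ∀ v ∈ l, v ∈ x.1} := h1
    _ ≤ (νmix Set.univ).real (ThinRingObs 0 0 s M) := measureReal_mono h2
    _ = (νmix Set.univ).real (ThinRingObs (a - s) (b - M - s) s M) := (stub_thinRingObs_shift _ _ s M).symm
    _ ≤ (νmix Set.univ).real (RingSeg a b s (2 * M + 3 * s)) := measureReal_mono h3

end Summit.CriticalPhenomena.CardyFormulaZ2.Theorems.IKLinearTransport.PinnedDiagramExchange.WallDomination

end
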